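import Literature.Geometry.Riemannian.AlmostNonnegRicciFibrationCovers
import Literature.Geometry.MetricGeometry.LinesInGHLimits
import Literature.Geometry.MetricGeometry.GeodesicGHLimits
import HarnessLib

/-!
# Huang–Huang–Wang–Zhu 2026, Main Theorem 1 at `n = 4`, `b₁ = 1`: what a pointed
Gromov–Hausdorff limit of the covers of a contradiction sequence inherits

Sixth reduction file for the named fact
`Literature.Geometry.Riemannian.huangHuangWangZhu2026_fibresOverCircle_four`. For a contradiction
sequence `D : (i : ℕ) → CoreDatum κ (δ i)` (`AlmostNonnegRicciFibrationSequential.lean`) the covers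
`(D i).Cover` with base points `p̂ i` are pointed proper geodesic metric spaces containing lines
within distance `1` of `p̂ i` (`AlmostNonnegRicciFibrationCovers.lean`). Huang–Huang–Wang–Zhu 2026,
§4 p. 13, pass to "the commutative diagram (4.1):
`(M̂ᵢ, p̂ᵢ, Hᵢ) →_GH (ℝˢ × Ŷ, (0ˢ, ŷ_∞), H)`", and the Euclidean factor of the limit comes from its
lines ("by the Cheeger–Gromoll's trick"). The existence of the limit (pointed Gromov–Hausdorff
precompactness under `Ric ≥ -δᵢ`, via Bishop–Gromov) and its splitting are the analytic core not in
the tree; this file records what ANY proper pointed Gromov–Hausdorff limit `(Y, q)` of the covers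
(in the tree's sense `PointedGHConv`) inherits from the tree's cover library:

* `CoreDatum.limit_exists_segment` — **`Y` is a geodesic space** (`GeodesicGHLimits.lean`);
* `CoreDatum.limit_exists_line` — **`Y` contains a line `σ` with `dist (σ 0) q ≤ 1`**
  (`LinesInGHLimits.lean`), in particular `Y` is not compact.

The instance bookkeeping (a SEQUENCE of metric spaces `(D i).Cover`, each with its own
`coverMetricSpace`) is done here once. Proved theorems only; no named facts; (E) untouched.

## References

* H. Huang, X.-T. Huang, J. Wang, X. Zhu, arXiv:2605.24380 (2026), §4 p. 13 (diagram (4.1), the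
  Cheeger–Gromoll trick). [HuangHuangWangZhu2026]
* P. Petersen, *Riemannian Geometry*, 2nd ed. (2006), Ch. 9, §3.2 Lemma 41. [Petersen2006]
-/

noncomputable section

open scoped Manifold ContDiff Topology
open Function Set Filter Metric

namespace Literature.Geometry.Riemannian

open Literature.Geometry.MetricGeometry Literature.Topology.FourManifolds.CircleMaps

namespace CoreDatum

variable {κ : ℝ} {δ : ℕ → ℝ} (D : (i : ℕ) → CoreDatum κ (δ i))

/-- The covers of a sequence of data as a sequence of metric spaces (each `(D i).Cover` with its
`coverMetricSpace`); a `def` producing the instance family consumed by `PointedGHConv`.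
[cite: HuangHuangWangZhu2026, §4 p. 13] -/
abbrev coverMetricSpaces : ∀ i, MetricSpace ((D i).Cover) := fun i ↦ (D i).coverMetricSpace

/-- **Any proper pointed Gromov–Hausdorff limit of the covers `(M̂ᵢ, p̂ᵢ)` is a geodesic space.**
[cite: HuangHuangWangZhu2026, §4 pp. 13–14] -/
theorem limit_exists_segment {Y : Type*} [MetricSpace Y] [ProperSpace Y]
    (p : ∀ i, (D i).Cover) {q : Y}
    (h : letI := coverMetricSpaces D; PointedGHConv p q) (y y' : Y) :
    ∃ σ : ℝ → Y, σ 0 = y ∧ σ (dist y y') = y' ∧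
      ∀ s ∈ Icc 0 (dist y y'), ∀ t ∈ Icc 0 (dist y y'), dist (σ s) (σ t) = |s - t| := by
  letI := coverMetricSpaces D
  exact h.exists_segment_of_forall_exists_segment (fun i x x' ↦ (D i).exists_segment_cover x x') y y'

/-- **Any proper pointed Gromov–Hausdorff limit `(Y, q)` of the covers `(M̂ᵢ, p̂ᵢ)` contains a line
within distance `1` of `q`** (lines within `1` of `p̂ᵢ` in every `M̂ᵢ`, `exists_line_cover`, pass
to the limit, `PointedGHConv.exists_isometry_real`) — the input of the Cheeger–Gromoll trick for
the limit `ℝˢ × Ŷ` of diagram (4.1). [cite: HuangHuangWangZhu2026, §4 p. 13] -/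
theorem limit_exists_line {Y : Type*} [MetricSpace Y] [ProperSpace Y]
    (p : ∀ i, (D i).Cover) {q : Y}
    (h : letI := coverMetricSpaces D; PointedGHConv p q) :
    ∃ σ : ℝ → Y, Isometry σ ∧ dist (σ 0) q ≤ 1 := by
  letI := coverMetricSpaces D
  exact h.exists_isometry_real fun i ↦ (D i).exists_line_cover (p i)

/-- Consequently such a limit is not compact (it contains a line). [cite: HuangHuangWangZhu2026, §4 p. 13] -/
theorem limit_noncompactSpace {Y : Type*} [MetricSpace Y] [ProperSpace Y]
    (p : ∀ i, (D i).Cover) {q : Y}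
    (h : letI := coverMetricSpaces D; PointedGHConv p q) : NoncompactSpace Y := by
  obtain ⟨σ, hσ, -⟩ := limit_exists_line D p h
  refine ⟨fun hc ↦ ?_⟩
  obtain ⟨r, -, hr⟩ := hc.isBounded.subset_closedBall_lt 0 q
  obtain ⟨x, y, hxy⟩ := exists_lt_dist_of_isometry_real hσ (2 * r)
  have hx := hr (mem_univ x)
  have hy := hr (mem_univ y)
  rw [mem_closedBall] at hx hy
  have := dist_triangle x q y
  rw [dist_comm q y] at this
  linarith

end CoreDatum

end Literature.Geometry.Riemannian
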